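import Mathlib
import Literature.Geometry.Lorentzian.GiorgiKlainermanSzeftel2022.GRWTransformationAlgebra

/-!
# Giorgi–Klainerman–Szeftel, *Wave equations estimates and the nonlinear stability of slowly rotating Kerr black holes* — App. D.1/D.2 ledger: the Teukolsky equation for `A` (Proposition 5.1.1) and its real/imaginary split (Corollary 5.1.2)

Sources, read side by side (every display was compared token by token; the loci of both are
given in every docstring):

* `[J]`  E. Giorgi, S. Klainerman, J. Szeftel, *Wave equations estimates and the nonlinear
  stability of slowly rotating Kerr black holes*, Pure Appl. Math. Q. **20** (2024), no. 7
  (doi:10.4310/pamq.241128023033) — Proposition 5.1.1 and Corollary 5.1.2 (file pp. p0188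
  L17–49, p0189 L5–35), Appendix D.1 "Proof of Proposition 5.1.1" (file pp. p0814 L5 – p0818
  L97, displays (D.1.1)–(D.1.6)) and Appendix D.2 "Proof of Corollary 5.1.2" (p0818 L99 – p0819
  L86, display (D.2.1)).  **Locator convention (as in the siblings `TeukolskyAbarLedger`,
  `QfbPRelationLedger`): `[J]` pages are the FILE pages `p0NNN` of the materialised journal PDF
  (= printed folio + 1), `Lnn` the line of its text layer.**
* `[v1]` the same authors, arXiv:2205.14808 (v1), TeX source lines `l.N`: Proposition
  `TEUKOLSKY-PROPOSITION` l.8567–8583 with (`Teukolsky-operator-ch5`) = `[J]` (5.1.2),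
  Corollary `COROLLARY-REAL-TEUK` l.8591–8603, Appendix sections `section:proof-teukolsky-eq`
  l.33469–33595 (displays `Bianchi-identity-A` = (D.1.1), `term1` … `term4`) and
  `proof-corollary-teukolsky` l.33600–33633 (display `eq:alternative-HovHb` = (D.2.1)).

The rows QUOTED by the text (they enter as hypotheses, verbatim): the conformal Bianchi
identities for `A`, `B`, `P` of `[J]` Proposition 2.4.15 (p0118 L33 ff.; `[v1]`
`prop:bianchi:complex-conf` l.5260, l.5261, l.5263 — both texts cite them as "Proposition
2.4.12", the number of the non-conformal Proposition, `[v1]` `\ref{prop:bianchi:complex}`); the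
conformal null-structure equations for `ᶜ∇₄tr X̲`, `ᶜ∇₄X̂`, `ᶜ∇₄H − ᶜ∇₃Ξ` and the Codazzi
equation for `X̂` of `[J]` Proposition 2.4.14 (p0117 L43 – p0118 L31; `[v1]`
`prop-nullstr:complex-conf` l.5238, l.5243, l.5247, l.5251); the commutator `[ᶜ∇₄, ᶜ𝒟⊗̂]F`
of `[J]` Lemma 4.2.2 (2), (4.2.13) p0163 L4–13 (`[v1]` `COMMUTATOR-NAB-C-3-DD-C-HOT`
l.7407–7410) at `s = 1`, `F = B`; the Leibniz rules (2.4.2) = `[v1]` (`simil-Leibniz`) l.4930,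
(2.4.3) = (`simil-Leib-half`) l.4934 of `[J]` Lemma 2.4.5 (p0111 L35–87) and (2.4.4) ∋
`[v1]` (`DD-hot-hF`) l.4983, (`Leibniz-hot`) l.4985, (2.4.5) = (`Leib-eq-DDb`) l.4992,
(`Leib-eq-DDb-DD-nab`) l.4993 of `[J]` Lemma 2.4.6 (p0112 L16–36); `[J]` Lemma 4.7.8 (p0182
L51–74; `[v1]` `LEMMA:CONFORMAL-DD-LAP` l.8260) applied to `A`.

## What is transcribed

App. D.1 derives `𝓛(A) = Err[𝓛(A)]` (`[J]` (5.1.1)) with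
`𝓛(A) = −ᶜ∇₄ᶜ∇₃A + ¼ ᶜ𝒟⊗̂(conj(ᶜ𝒟)·A) + (−½ tr X − 2 conj(tr X)) ᶜ∇₃A − ½ tr X̲ ᶜ∇₄A
+ (4H + H̲ + H̲̄)·ᶜ∇A + (−conj(tr X) tr X̲ + 2P̄)A + H⊗̂(H̲̄·A)` (`[J]` (5.1.2) = `[v1]`
l.8573–8578) by applying `ᶜ∇₄` to the Bianchi identity (D.1.1)
`ᶜ∇₃A − ½ ᶜ𝒟⊗̂B = −½ tr X̲ A + 2H⊗̂B − 3P̄X̂`, commuting `ᶜ∇₄` through `ᶜ𝒟⊗̂`, substituting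
the Bianchi identity for `ᶜ∇₄B` ((D.1.2), then (D.1.3) after the Kerr-value rewriting
`ᶜ𝒟P̄ = −3P̄H + r⁻¹𝔡̸^{≤1}P̌ + r⁻³Γ_b`), the transport equation for `tr X̲` ((D.1.4)), the one
for `H` ((D.1.5)) and the ones for `X̂`, `P̄` ((D.1.6)); summing `½(D.1.3) + (D.1.4) + ½(D.1.5)
+ (D.1.6)`, re-using (D.1.1), absorbing the `⊗̂B` line by the Codazzi equation, and simplifying
the angular terms by the Leibniz rules (2.4.2), (2.4.4), (2.4.5).  App. D.2 splits `𝓛` into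
`Re(𝓛) + i Im(𝓛)` (`[J]` Corollary 5.1.2) using Lemma 4.7.8 for `ᶜ𝒟⊗̂(conj(ᶜ𝒟)·A)`, the
definitions `tr X = tr χ − iªtr χ`, `tr X̲ = tr χ̲ − iªtr χ̲`, `P = ρ + i*ρ`, `H = η + i*η`,
`H̲ = η̲ + i*η̲` (`[J]` Definition 2.4.8, p0113 L29–58; `[v1]` l.5040–5060) and (2.4.3)
in the form (D.2.1) `H⊗̂(H̲̄·A) = (4η·η̲ − 4iη∧η̲)A`.

## How it is typed (the scalar–module shadow of the siblings; nothing tensorial is derived)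

* An abstract field `K` of characteristic `0` (think: complex scalar functions); `K`-modules
  `M₁` (complex horizontal 1-forms `𝔰₁(ℂ)`) and `M₂` (`𝔰₂(ℂ)`).  Complex conjugates are
  INDEPENDENT symbols (`x = tr X`, `xc = conj(tr X)`, `xb = tr X̲`, `pb = P̄`; `H`, `Hb = H̲`,
  `cHb = conj(H̲)`): no identity between a quantity and its conjugate is used by the text in
  D.1, and in D.2 the real/imaginary parts are themselves the symbols.
* `ᶜ∇₄` is `GRWTransformationAlgebra.CovD` (used BY NAME, nothing restated): a scalar
  derivation `D4 : Derivation ℤ K K` and Leibniz operators `N1 : CovD D4 M₁`, `N2 : CovD D4 M₂`;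
  its Leibniz rule over `⊗̂` is the hypothesis `hN4hot`.  `ᶜ𝒟` on scalars is a derivation
  `dd : Derivation ℤ K M₁` (values in 1-forms); `ᶜ𝒟⊗̂` on 1-forms is an additive `Dh : M₁ →+ M₂`
  whose Leibniz rule `ᶜ𝒟⊗̂(hF) = h ᶜ𝒟⊗̂F + ᶜ𝒟h⊗̂F` (`[v1]` (`DD-hot-hF`) l.4983, in `[J]`
  (2.4.4)) is the hypothesis `hDhL`; `⊗̂` is a genuinely bilinear `hot : M₁ →ₗ M₁ →ₗ M₂`, so
  every bilinear expansion the text performs is kernel-checked; `F ↦ (F·conj(ᶜ𝒟))A`,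
  `F ↦ (F·ᶜ𝒟)A`, `F ↦ F·ᶜ∇A` are linear maps `FDb, FD, Fnab : M₁ →ₗ M₂` (only their additivity
  in `F` is used, as in the text's last display of D.1).  `ᶜ∇₃A`, `ᶜ∇₃Ξ`, `conj(ᶜ𝒟)·A`,
  `H̲̄·A` (= the `A·H̲̄` of the `B`-identity), `X̂·(H̄ − H̲̄)`, `conj(ᶜ𝒟)·X̂`, and every
  schematic symbol are OPAQUE elements, one per occurrence: `G1` = the `r⁻¹Γ_g·𝔡^{≤1}B` of the
  quoted commutator, `gb1` = the `Γ_b·Γ_g` of the `tr X̲` equation, `sP` = the non-principal part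
  of the (conjugated) `P`-identity, `EP` = the `r⁻¹𝔡̸^{≤1}P̌ + r⁻³Γ_b` of `[J]`'s rewriting of
  `ᶜ𝒟P̄`, `jx`/`jxi` = the coefficients `i Im(tr X)` of `H` and of `Ξ` in the quoted Codazzi
  equation.  Every "we obtain / this gives / which implies" display is then a THEOREM whose
  schematic terms are carried as an explicit sum of these elements — never absorbed — and the
  docstring says which printed schematic symbol the sum is.
* Nothing is a `def`; every quoted row is a hypothesis of the theorem that uses it; the final
  theorem `D1_teukolsky_of_rows` composes the whole derivation from the quoted rows.

## Certified (0 sorry; every theorem closes by `simp`/`rw` + `module`/`match_scalars`)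

(D.1.2)–(D.1.6) as displayed; the weights of the sum (`D1_weights`: the display obtained by
applying `ᶜ∇₄` to (D.1.1) IS `½·(D.1.3-lhs) + (D.1.4-lhs) + ½·(D.1.5-lhs) + (D.1.6-lhs)`); the
summed display, in which the `Ξ`-channel `(3/2)P̄[(H + H̲)⊗̂Ξ − Ξ⊗̂(H̲ + H)]` vanishes by the
symmetry of `⊗̂` and the `⊗̂B`-coefficient is `−ᶜ𝒟 conj(tr X) − 5 conj(tr X) H` (the `H̲`-parts
`−conj(tr X)H̲ + conj(tr X)H̲` cancel only with the weight `½` on (D.1.5)); "Using again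
(D.1.1)"; "This gives" (`⊗̂B`-coefficient `−ᶜ𝒟 conj(tr X) + (tr X − conj tr X)H`, `A`-coefficient
`−conj(tr X) tr X̲ − ½(ᶜ𝒟·H̲̄ + H̲·H̲̄) + 2P̄`); the Codazzi absorption (the `H⊗̂B` terms cancel
EXACTLY, for any value of the `Ξ`-coefficient, leaving `−conj(ᶜ𝒟)·X̂⊗̂B − 2jxi Ξ⊗̂B − 2B⊗̂B`);
the angular simplification to `(4H + H̲ + H̲̄)·ᶜ∇A`; and `𝓛(A) = −(R₁ + R₂)` with the error
term itemised (`D1_teukolsky`, `D1_teukolsky_of_rows`).  The Kerr-value identity behind `[J]`'s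
rewriting of `ᶜ𝒟P̄` (`D1_writing`, an identity for ANY derivation).  D.2: the three scalar
rewritings and `𝓛(A) = Re(𝓛)(A) + i Im(𝓛)(A)` with the printed `Re(𝓛)`, `Im(𝓛)` of
Corollary 5.1.2 (`D2_split`; one coefficient needs `i² = −1`, the rest are formal).

## Divergence `[J]` vs `[v1]` found by collation (offered to the cell's census, not rulings)

Δ1. `[J]` p0815 L60–110 inserts, between (D.1.2) and the transport equations, "Writing,
    `ᶜ𝒟P̄ = 𝒟(P̌̄ − 2m/q̄³) = −3P̄H + … = −3P̄H + r⁻¹𝔡̸^{≤1}P̌ + r⁻³Γ_b`, we have (D.1.3)", and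
    (D.1.3) carries `3P̄(ᶜ𝒟⊗̂Ξ + (H + H̲)⊗̂Ξ) + r⁻¹𝔡̸^{≤1}P̌·Ξ + r⁻³Γ_b·Ξ` where `[v1]` `term1`
    l.33505 keeps `3P̄(ᶜ𝒟⊗̂Ξ + (4H + H̲)⊗̂Ξ) + 3ᶜ𝒟P̄⊗̂Ξ`.  `[v1]`'s summed display l.33543–33547
    nevertheless shows no `Ξ`-terms: it silently drops `(9/2)P̄H⊗̂Ξ + (3/2)ᶜ𝒟P̄⊗̂Ξ`
    (`D1_v1_Xi_channel`), which vanish exactly under `[J]`'s rewriting (second conjunct).  The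
    middle member of `[J]`'s "Writing" display is illegible in the text layer (glyph check owed
    on a page image); `D1_writing` certifies the identity
    `𝒟(P̌̄ − 2m/q̄³) = −3P̄H + 𝒟P̌̄ + 3P̌̄H + (6m/q̄⁴)(𝒟q̄ − q̄H)`, the only one consistent with
    the legible outer members (`𝒟q̄ − q̄H = Γ_b` by `H = 𝒟q̄/q̄ + r⁻¹Γ_b`, `[v1]` l.9412; `= 0` in
    Kerr, `[J]` p0131 L29, `[v1]` l.5941; on explicit Kerr parts the same cancellation is
    `TeukolskyAbarLedger.D54_calD_Pbar`).
Δ2. `[J]` p0816 L85 "Summing ½(D.1.3), (D.1.4), ½(D.1.5) and (D.1.6)" where `[v1]` l.33541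
    prints "Summing ½(term1), (term2), (term3) and (term4)".  The weights are forced
    (`D1_weights`); with weight `1` on `term3` one gets `ᶜ∇₄ᶜ∇₃A + 2ᶜ∇₄H⊗̂B`
    (`D1_v1_weights_gap`), and the printed `⊗̂B`-coefficient `−5 conj(tr X)H` of BOTH summed
    displays is the `½`-weighted one.  `[v1]`'s words slip, its display is right.
Δ3. Error term.  `[J]` (5.1.3) p0188 L49, and its summed/final displays p0816 L128, p0817 L41,
    p0818 L69, print `Err[𝓛(A)] = r⁻¹𝔡^{≤1}Γ_g·B + ᶜ∇₃Ξ·B + r⁻¹𝔡̸^{≤1}P̌·Ξ + r⁻³Γ_b·Ξ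
    + (Γ_g·Ξ)·B` (under-bars are not in the text layer; `(Γ_g·Ξ)·B̲` is the natural reading of
    the `X̂(Ξ·conj B̲)` produced by the `P`-identity) — i.e. `[J]` ADDS the `Ξ`-terms of Δ1 and
    the `(Γ_g·Ξ)·B` of (D.1.6), and DROPS the `Γ_b·Γ_g·A` that `[v1]` (l.8581, l.33547, l.33561,
    l.33587) and `[J]`'s own (D.1.4), (D.1.6) (p0815 L136, p0816 L70, L84) carry.  In the ledger
    the error term is the explicit `−(R₁ + R₂)` of `D1_teukolsky`, which contains both
    (`−½gb1·A`, `−3sP·X̂`); whether `[J]`'s omission of the cubic `Γ_b·Γ_g·A` is deliberate is a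
    question for the census.
All three: `[J]` ⊇ the correction of `[v1]`; NIL load on the certified algebra.

## Readings at symbol level (not kernel data beyond the stated identities)

R1. The commutator is quoted (`[v1]` l.33485 = `[J]` p0814 L46–53) as
    `[ᶜ∇₄, ᶜ𝒟⊗̂]B = −½ tr X ᶜ𝒟⊗̂B + H̲⊗̂ᶜ∇₄B + r⁻¹Γ_g·𝔡^{≤1}B`, whereas (4.2.13) at `s = 1`
    (`[J]` p0163 L4–13, `[v1]` l.7407–7410) also prints `+ Ξ⊗̂ᶜ∇₃B` (the precise (4.2.12),
    `[v1]` l.7396–7400, moreover `−2B⊗̂B − tr X̲ Ξ⊗̂B − ½X̂·conj(ᶜ𝒟)B + ½X̂(H̲̄·B) + ½(X̂·H̲̄)⊗̂B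
    + (Γ_b·Γ_g)B`).  Here all of it is the one opaque `G1`.
R2. The Codazzi equation is quoted (`[v1]` l.33565 = `[J]` p0817 L43–49) with
    `−i Im(tr X)(H + Ξ)` where Proposition 2.4.14 (`[J]` p0118 L26–31, `[v1]` l.5251) prints
    `−i Im(tr X)H − i Im(tr X̲)Ξ`.  The absorption theorem holds for ANY `Ξ`-coefficient `jxi`
    (`D1_codazzi_absorb`), so the reading is immaterial here.
R3. `[v1]` `term4` l.33537 → l.33538 drops `+ Γ_b·Γ_g·A` inside one display; `[J]` (D.1.6)
    keeps it (p0816 L70, L84).  `[v1]` l.33495/`[J]` p0814 L87 write `½A·H̲̄` in the quoted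
    `B`-identity and `H̲̄·A` from (D.1.2) on (the same contraction; one symbol `cHbA` here).
R4. The transport equation for `tr X̲` is quoted with `+ Γ_b·Γ_g` for the
    `+ Ξ·conj(Ξ̲) − ½X̂·conj(X̲̂)` of Proposition 2.4.14 (`[v1]` l.5238), and the `P`-identity with
    `+ Γ_b·A` for its `−¼X̲̂·Ā` (`[v1]` l.5263); the text uses the COMPLEX CONJUGATE of the
    quoted `P`-row (for `ᶜ∇₄P̄`), whose non-principal part is the opaque scalar `sP` here.

## Not claimed

No tensorial statement, commutation formula, Bianchi or null-structure equation is derived;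
conjugation, the decay classes `Γ_g, Γ_b`, the symbols `r⁻ᵏ𝔡^{≤1}`, and the absorption
"the second line is absorbed by the quadratic terms in the last line" beyond the exact identity
`D1_codazzi_absorb` are outside the model; that `Re(𝓛)`, `Im(𝓛)` are real operators is not
expressible here.  Nothing here is a hypothesis-fact of `[J]`; no `def … : Prop`.  This module
is a typed reading aid for the cell's census of `[J]` ch. 5 / App. D, not progress on any summit.
-/

namespace Literature.Geometry.Lorentzian.GiorgiKlainermanSzeftel2022.TeukolskyALedger

open Literature.Geometry.Lorentzian.GiorgiKlainermanSzeftel2022.GRWTransformationAlgebra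

variable {K : Type*} [Field K]

/-! ## §0 Private helpers: a derivation (with values in any module) kills the numerals met below -/

/-- `D 2 = D 3 = D 4 = D ½ = D ¼ = 0` for a `ℤ`-derivation of a field with values in a module;
private helper for the Leibniz expansions below (cf. `GRWTransformationAlgebra.D_num`, the
scalar-valued case). [folklore] -/
private theorem dconsts {M : Type*} [AddCommGroup M] [Module K M] (D : Derivation ℤ K M) :
    D (2 : K) = 0 ∧ D (3 : K) = 0 ∧ D (4 : K) = 0 ∧ D (1/2 : K) = 0 ∧ D (1/4 : K) = 0 := by
  have h2 : D (2 : K) = 0 := by rw [← Nat.cast_ofNat]; exact D.map_natCast _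
  have h3 : D (3 : K) = 0 := by rw [← Nat.cast_ofNat]; exact D.map_natCast _
  have h4 : D (4 : K) = 0 := by rw [← Nat.cast_ofNat]; exact D.map_natCast _
  refine ⟨h2, h3, h4, ?_, ?_⟩
  · rw [one_div, D.leibniz_inv, h2, smul_zero]
  · rw [one_div, D.leibniz_inv, h4, smul_zero]

/-! ## §1 The cast of App. D.1

Scalars (`K`): `x = tr X`, `xc = conj(tr X)`, `xb = tr X̲`, `pb = P̄`, `dcHb = ᶜ𝒟·H̲̄`,
`hh = H̲·H̲̄`, `gb1` (the `Γ_b·Γ_g` of the quoted `tr X̲`-equation), `sP` (the non-principal part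
`½conj(ᶜ𝒟)·B + H̲̄·B − Ξ·conj(B̲) + Γ_b·Ā` of the conjugated `P`-identity), `rex = Re(tr X)`,
`jx = i Im(tr X)` (so `2jx = x − xc`), `jxi` = the coefficient of `Ξ` in the quoted Codazzi
equation (`i Im(tr X)` as quoted in D.1, `i Im(tr X̲)` in Proposition 2.4.14 — reading R2).
1-forms (`M₁`): `H`, `Hb = H̲`, `cHb = H̲̄`, `Xi = Ξ`, `B`, `dbA = conj(ᶜ𝒟)·A`, `cHbA = H̲̄·A`,
`n3Xi = ᶜ∇₃Ξ`, `XhH = X̂·(H̄ − H̲̄)`, `dbXh = conj(ᶜ𝒟)·X̂`, `EP` (the `r⁻¹𝔡̸^{≤1}P̌ + r⁻³Γ_b` of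
`[J]` p0815 L74).  2-tensors (`M₂`): `A`, `Xh = X̂`, `n3A = ᶜ∇₃A`, `G1` (the
`r⁻¹Γ_g·𝔡^{≤1}B` of the quoted commutator).  Operators: `D4`/`N1`/`N2` = `ᶜ∇₄` on scalars /
1-forms / 2-tensors, `dd = ᶜ𝒟` on scalars, `Dh = ᶜ𝒟⊗̂`, `hot = ⊗̂`, `FDb F = (F·conj(ᶜ𝒟))A`,
`FD F = (F·ᶜ𝒟)A`, `Fnab F = F·ᶜ∇A`.

The two remainders that the theorems carry explicitly:
`R₁ = ½G1 − ½gb1·A + (2 ᶜ∇₃Ξ⊗̂B − (X̂·(H̄ − H̲̄))⊗̂B − 2B⊗̂B) + (3/2)EP⊗̂Ξ − 3sP·X̂`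
(`[J]`: `r⁻¹𝔡^{≤1}Γ_g·B + ᶜ∇₃Ξ·B + r⁻¹𝔡̸^{≤1}P̌·Ξ + r⁻³Γ_b·Ξ + (Γ_g·Ξ)·B`; `[v1]`:
`r⁻¹𝔡^{≤1}(Γ_g·B) + ᶜ∇₃Ξ·B + Γ_b·Γ_g·A`) and
`R₂ = −(conj(ᶜ𝒟)·X̂)⊗̂B − 2jxi Ξ⊗̂B − 2B⊗̂B` (the "quadratic terms" of the Codazzi absorption). -/

section D1

variable [CharZero K]
variable {M₁ M₂ : Type*} [AddCommGroup M₁] [Module K M₁] [AddCommGroup M₂] [Module K M₂]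
variable {D4 : Derivation ℤ K K} (N1 : CovD D4 M₁) (N2 : CovD D4 M₂)
variable (dd : Derivation ℤ K M₁) (Dh : M₁ →+ M₂) (hot : M₁ →ₗ[K] M₁ →ₗ[K] M₂)
variable (FDb FD Fnab : M₁ →ₗ[K] M₂)
variable (x xc xb pb dcHb hh gb1 sP rex jx jxi : K)
variable (H Hb cHb Xi B dbA cHbA n3Xi XhH dbXh EP : M₁)
variable (A Xh n3A G1 : M₂)

/-- "We apply `ᶜ∇₄` to (D.1.1): `ᶜ∇₄ᶜ∇₃A = ½ᶜ∇₄(ᶜ𝒟⊗̂B) − ½ᶜ∇₄tr X̲ A − ½tr X̲ ᶜ∇₄A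
+ 2ᶜ∇₄(H)⊗̂B + 2H⊗̂ᶜ∇₄(B) − 3ᶜ∇₄P̄ X̂ − 3P̄ ᶜ∇₄X̂`" — a THEOREM of the Leibniz rules of `ᶜ∇₄`
(`CovD.leibniz`, and `hN4hot` over `⊗̂`) applied to the quoted Bianchi identity (D.1.1)
`ᶜ∇₃A − ½ᶜ𝒟⊗̂B = −½tr X̲ A + 2H⊗̂B − 3P̄X̂` (`hA`; `[J]` Proposition 2.4.15, `[v1]` l.5260).
[cite: GiorgiKlainermanSzeftel2024, p0814 L7–44 (D.1.1); GiorgiKlainermanSzeftel2022, l.33474–33482] -/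
theorem D1_apply_nab4
    (hN4hot : ∀ u v : M₁, N2.op (hot u v) = hot (N1.op u) v + hot u (N1.op v))
    (hA : n3A - (1/2 : K) • Dh B = -(((1/2 : K) * xb) • A) + (2 : K) • hot H B - (3 * pb) • Xh) :
    N2.op n3A = (1/2 : K) • N2.op (Dh B) - ((1/2 : K) * D4 xb) • A - ((1/2 : K) * xb) • N2.op A
      + (2 : K) • hot (N1.op H) B + (2 : K) • hot H (N1.op B) - (3 * D4 pb) • Xh
      - (3 * pb) • N2.op Xh := by
  obtain ⟨d2, d3, -, dh, -⟩ := dconsts D4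
  rw [sub_eq_iff_eq_add'] at hA
  rw [hA]
  simp only [map_add, map_sub, map_neg, N2.leibniz, hN4hot, Derivation.leibniz, smul_eq_mul, d2, d3,
    dh, mul_zero, add_zero, zero_smul, zero_add]
  module

/-- "According to Lemma 4.2.2 applied to `B`, which is `1`-conformally invariant, we have
`[ᶜ∇₄, ᶜ𝒟⊗̂]B = −½tr X (ᶜ𝒟⊗̂B) + H̲⊗̂ᶜ∇₄B + r⁻¹Γ_g·𝔡^{≤1}B` (`hcomm`, the opaque `G1` being the
last term; reading R1 of the header).  We therefore obtain `ᶜ∇₄(ᶜ𝒟⊗̂B) + 4H⊗̂ᶜ∇₄(B)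
= ᶜ𝒟⊗̂(ᶜ∇₄B) + (4H + H̲)⊗̂ᶜ∇₄B − ½tr X ᶜ𝒟⊗̂B + r⁻¹Γ_g·𝔡^{≤1}B`."
[cite: GiorgiKlainermanSzeftel2024, p0814 L46–75, (4.2.13) p0163 L4–13; GiorgiKlainermanSzeftel2022, l.33483–33492, l.7407–7410] -/
theorem D1_we_therefore_obtain
    (hcomm : N2.op (Dh B) - Dh (N1.op B) = -(((1/2 : K) * x) • Dh B) + hot Hb (N1.op B) + G1) :
    N2.op (Dh B) + (4 : K) • hot H (N1.op B)
      = Dh (N1.op B) + hot ((4 : K) • H + Hb) (N1.op B) - ((1/2 : K) * x) • Dh B + G1 := by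
  rw [sub_eq_iff_eq_add'] at hcomm
  rw [hcomm]
  simp only [map_add, map_smul, LinearMap.add_apply, LinearMap.smul_apply]
  module

/-- (D.1.2) = `[v1]` (`term1`): "According to Proposition 2.4.12, we have the following Bianchi
identity for `B`: `ᶜ∇₄B − ½conj(ᶜ𝒟)·A = −2conj(tr X)B + ½A·H̲̄ + 3P̄Ξ` (`hBB`; `[J]` Proposition
2.4.15, `[v1]` l.5261).  This gives `ᶜ∇₄(ᶜ𝒟⊗̂B) + 4H⊗̂ᶜ∇₄(B) = ½ᶜ𝒟⊗̂(conj(ᶜ𝒟)·A + H̲̄·A)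
+ (−½tr X − 2conj(tr X))ᶜ𝒟⊗̂B + (2H + ½H̲)⊗̂(conj(ᶜ𝒟)·A + H̲̄·A)
+ 2(−ᶜ𝒟conj(tr X) − conj(tr X)(4H + H̲))⊗̂B + 3P̄(ᶜ𝒟⊗̂Ξ + (4H + H̲)⊗̂Ξ) + 3ᶜ𝒟P̄⊗̂Ξ
+ r⁻¹Γ_g·𝔡^{≤1}B`" — a THEOREM of the previous display (`hWTO`), the `B`-identity and the
Leibniz rule `ᶜ𝒟⊗̂(hF) = hᶜ𝒟⊗̂F + ᶜ𝒟h⊗̂F` (`hDhL`, `[v1]` (`DD-hot-hF`) l.4983).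
[cite: GiorgiKlainermanSzeftel2024, p0814 L76 – p0815 L58 (D.1.2); GiorgiKlainermanSzeftel2022, l.33493–33507] -/
theorem D1_2
    (hWTO : N2.op (Dh B) + (4 : K) • hot H (N1.op B)
      = Dh (N1.op B) + hot ((4 : K) • H + Hb) (N1.op B) - ((1/2 : K) * x) • Dh B + G1)
    (hBB : N1.op B - (1/2 : K) • dbA = -((2 * xc) • B) + (1/2 : K) • cHbA + (3 * pb) • Xi)
    (hDhL : ∀ (f : K) (u : M₁), Dh (f • u) = f • Dh u + hot (dd f) u) :
    N2.op (Dh B) + (4 : K) • hot H (N1.op B)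
      = (1/2 : K) • Dh (dbA + cHbA) + (-((1/2 : K) * x) - 2 * xc) • Dh B
        + hot ((2 : K) • H + (1/2 : K) • Hb) (dbA + cHbA)
        + (2 : K) • hot (-dd xc - xc • ((4 : K) • H + Hb)) B
        + (3 * pb) • (Dh Xi + hot ((4 : K) • H + Hb) Xi) + (3 : K) • hot (dd pb) Xi + G1 := by
  obtain ⟨d2, d3, -, dh, -⟩ := dconsts dd
  rw [sub_eq_iff_eq_add'] at hBB
  rw [hWTO, hBB]
  simp only [map_add, map_neg, map_sub, hDhL, map_smul, LinearMap.add_apply, LinearMap.smul_apply,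
    LinearMap.neg_apply, LinearMap.sub_apply, Derivation.leibniz, d2, d3, dh, smul_zero, add_zero,
    map_zero, LinearMap.zero_apply]
  module

end D1

/-! ## §2 `[J]`'s rewriting of `ᶜ𝒟P̄` on Kerr values (the "Writing" display, `[J]` only) -/

section Writing

variable {M₁ : Type*} [AddCommGroup M₁] [Module K M₁]

/-- "Writing, `ᶜ𝒟P̄ = 𝒟(P̌̄ − 2m/q̄³) = −3P̄H + 𝒟(P̌̄) + … = −3P̄H + r⁻¹𝔡̸^{≤1}P̌ + r⁻³Γ_b`"
(`P̌ := P + 2m/q³`, `[J]` Definition 4.1.1 (4.1.1) p0157 L30, `[v1]` l.7122; conjugated).  For ANY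
derivation `𝒟` killing `m`, and any 1-form `H`:
`𝒟(P̌̄ − 2m/q̄³) = −3(P̌̄ − 2m/q̄³)H + (𝒟P̌̄ + 3P̌̄H + (6m/q̄⁴)(𝒟q̄ − q̄H))` (first conjunct);
and if `𝒟q̄ = q̄H + gq` (`H = 𝒟q̄/q̄ + r⁻¹Γ_b`, `[v1]` l.9412; `𝒟q̄ = Hq̄` in Kerr, `[J]` p0131
L29, `[v1]` l.5941) the bracket is `𝒟P̌̄ + 3P̌̄H + (6m/q̄⁴)gq` (second conjunct) — the
`r⁻¹𝔡̸^{≤1}P̌ + r⁻³Γ_b` of the display.  DIVERGENCE Δ1 of the header: this step and the ensuing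
(D.1.3) are in `[J]` only; the middle member of the display is illegible in the text layer and
this identity is the one consistent with its legible outer members.  (On explicit Kerr parts the
same cancellation is `TeukolskyAbarLedger.D54_calD_Pbar`.)
[cite: GiorgiKlainermanSzeftel2024, p0815 L60–76, (4.1.1) p0157 L30; GiorgiKlainermanSzeftel2022, l.7122, l.9412, l.5941] -/
theorem D1_writing (dd : Derivation ℤ K M₁) (m qb Pck pb : K) (H gq : M₁) (hqb : qb ≠ 0)
    (hm : dd m = 0) (hpb : pb = Pck - 2 * m / qb ^ 3) :
    dd pb = -(3 * pb) • H + (dd Pck + (3 * Pck) • H + (6 * m / qb ^ 4) • (dd qb - qb • H)) ∧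
      (dd qb = qb • H + gq →
        dd pb = -(3 * pb) • H + (dd Pck + (3 * Pck) • H + (6 * m / qb ^ 4) • gq)) := by
  have h2 : dd (2 : K) = 0 := (dconsts dd).1
  have main : dd pb = -(3 * pb) • H + (dd Pck + (3 * Pck) • H + (6 * m / qb ^ 4) • (dd qb - qb • H)) := by
    subst hpb
    simp only [map_sub, dd.leibniz_div, dd.leibniz, dd.leibniz_pow, hm, h2, smul_zero, add_zero,
      smul_sub]
    match_scalars <;> field_simp <;> ring
  refine ⟨main, fun hq => ?_⟩
  rw [main, hq]
  module

end Writing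

section D1

variable [CharZero K]
variable {M₁ M₂ : Type*} [AddCommGroup M₁] [Module K M₁] [AddCommGroup M₂] [Module K M₂]
variable {D4 : Derivation ℤ K K} (N1 : CovD D4 M₁) (N2 : CovD D4 M₂)
variable (dd : Derivation ℤ K M₁) (Dh : M₁ →+ M₂) (hot : M₁ →ₗ[K] M₁ →ₗ[K] M₂)
variable (FDb FD Fnab : M₁ →ₗ[K] M₂)
variable (x xc xb pb dcHb hh gb1 sP rex jx jxi : K)
variable (H Hb cHb Xi B dbA cHbA n3Xi XhH dbXh EP : M₁)
variable (A Xh n3A G1 : M₂)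

/-- (D.1.3) (`[J]` only; divergence Δ1): with `ᶜ𝒟P̄ = −3P̄H + r⁻¹𝔡̸^{≤1}P̌ + r⁻³Γ_b` (`hDPb`,
the opaque `EP` being the last two terms), (D.1.2) becomes "`ᶜ∇₄(ᶜ𝒟⊗̂B) + 4H⊗̂ᶜ∇₄(B) = … +
2(−ᶜ𝒟conj(tr X) − conj(tr X)(4H + H̲))⊗̂B + 3P̄(ᶜ𝒟⊗̂Ξ + (H + H̲)⊗̂Ξ) + r⁻¹𝔡̸^{≤1}P̌·Ξ
+ r⁻³Γ_b·Ξ + r⁻¹Γ_g·𝔡^{≤1}B`" (`3P̄·4H⊗̂Ξ − 9P̄H⊗̂Ξ = 3P̄H⊗̂Ξ`); the printed `·Ξ` terms are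
`3EP⊗̂Ξ` here.
[cite: GiorgiKlainermanSzeftel2024, p0815 L60–110 (D.1.3); GiorgiKlainermanSzeftel2022, l.33497–33507] -/
theorem D1_3
    (h12 : N2.op (Dh B) + (4 : K) • hot H (N1.op B)
      = (1/2 : K) • Dh (dbA + cHbA) + (-((1/2 : K) * x) - 2 * xc) • Dh B
        + hot ((2 : K) • H + (1/2 : K) • Hb) (dbA + cHbA)
        + (2 : K) • hot (-dd xc - xc • ((4 : K) • H + Hb)) B
        + (3 * pb) • (Dh Xi + hot ((4 : K) • H + Hb) Xi) + (3 : K) • hot (dd pb) Xi + G1)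
    (hDPb : dd pb = -((3 * pb) • H) + EP) :
    N2.op (Dh B) + (4 : K) • hot H (N1.op B)
      = (1/2 : K) • Dh (dbA + cHbA) + (-((1/2 : K) * x) - 2 * xc) • Dh B
        + hot ((2 : K) • H + (1/2 : K) • Hb) (dbA + cHbA)
        + (2 : K) • hot (-dd xc - xc • ((4 : K) • H + Hb)) B
        + (3 * pb) • (Dh Xi + hot (H + Hb) Xi) + (3 : K) • hot EP Xi + G1 := by
  rw [h12, hDPb]
  simp only [map_add, map_neg, map_smul, LinearMap.add_apply, LinearMap.smul_apply, LinearMap.neg_apply]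
  module

/-- (D.1.4) = `[v1]` (`term2`): "According to Proposition 2.4.14, we have the following null
structure equation: `ᶜ∇₄tr X̲ + ½tr X tr X̲ = ᶜ𝒟·H̲̄ + H̲·H̲̄ + 2P̄ + Γ_b·Γ_g` (`htrXb`, the opaque
`gb1` being the last term; reading R4), which gives `−½ᶜ∇₄tr X̲ A − ½tr X̲ ᶜ∇₄A
= (¼tr X tr X̲ − ½(ᶜ𝒟·H̲̄ + H̲·H̲̄) − P̄)A − ½tr X̲ ᶜ∇₄A + Γ_b·Γ_g·A`"; the printed `Γ_b·Γ_g·A`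
is `−½gb1·A` here.
[cite: GiorgiKlainermanSzeftel2024, p0815 L112–136 (D.1.4); GiorgiKlainermanSzeftel2022, l.33508–33518, l.5238] -/
theorem D1_4 (htrXb : D4 xb + (1/2 : K) * x * xb = dcHb + hh + 2 * pb + gb1) :
    -(((1/2 : K) * D4 xb) • A) - ((1/2 : K) * xb) • N2.op A
      = ((1/4 : K) * x * xb - (1/2 : K) * (dcHb + hh) - pb) • A - ((1/2 : K) * xb) • N2.op A
        - ((1/2 : K) * gb1) • A := by
  have h : D4 xb = dcHb + hh + 2 * pb + gb1 - (1/2 : K) * x * xb := by linear_combination htrXb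
  rw [h]
  module

/-- (D.1.5) = `[v1]` (`term3`): "According to Proposition 2.4.14, we have the following null
structure equation: `ᶜ∇₄H − ᶜ∇₃Ξ = −½conj(tr X)(H − H̲) − ½X̂·(H̄ − H̲̄) − B` (`hH4`; `[v1]`
l.5247), which gives `4ᶜ∇₄(H)⊗̂B = −2conj(tr X)(H − H̲)⊗̂B + (ᶜ∇₃Ξ + r⁻¹Γ_g)·B`"; the printed
`(ᶜ∇₃Ξ + r⁻¹Γ_g)·B` is the explicit `4ᶜ∇₃Ξ⊗̂B − 2(X̂·(H̄ − H̲̄))⊗̂B − 4B⊗̂B` here.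
[cite: GiorgiKlainermanSzeftel2024, p0816 L5–26 (D.1.5); GiorgiKlainermanSzeftel2022, l.33519–33526, l.5247] -/
theorem D1_5 (hH4 : N1.op H - n3Xi = -(((1/2 : K) * xc) • (H - Hb)) - (1/2 : K) • XhH - B) :
    (4 : K) • hot (N1.op H) B
      = -((2 * xc) • hot (H - Hb) B) + ((4 : K) • hot n3Xi B - (2 : K) • hot XhH B - (4 : K) • hot B B) := by
  rw [sub_eq_iff_eq_add'] at hH4
  rw [hH4]
  simp only [map_add, map_sub, map_neg, map_smul, LinearMap.add_apply, LinearMap.sub_apply,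
    LinearMap.neg_apply, LinearMap.smul_apply]
  module

/-- (D.1.6) = `[v1]` (`term4`): "Finally using again Proposition 2.4.14 and Proposition 2.4.12,
`ᶜ∇₄X̂ + Re(tr X)X̂ = ½ᶜ𝒟⊗̂Ξ + ½Ξ⊗̂(H̲ + H) − A` (`hXh4`, `[v1]` l.5243; `Re(tr X) = ½(tr X
+ conj(tr X))`, `hrex`), `ᶜ∇₄P − ½ᶜ𝒟·B̄ = −(3/2)tr X P + H̲·B̄ − Ξ̄·B̲ + Γ_b·A` (used
conjugated: `ᶜ∇₄P̄ = −(3/2)conj(tr X)P̄ + sP`, `hP4`, reading R4), we obtain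
`−3ᶜ∇₄P̄ X̂ − 3P̄ᶜ∇₄X̂ = −3(−(3/2)conj(tr X)P̄)X̂ − 3P̄(−½(tr X + conj(tr X))X̂ − A + ½ᶜ𝒟⊗̂Ξ
+ ½Ξ⊗̂(H̲ + H)) + … = ((3/2)tr X + 6conj(tr X))P̄X̂ + 3P̄A − (3/2)P̄(ᶜ𝒟⊗̂Ξ + Ξ⊗̂(H̲ + H))
+ r⁻¹Γ_g·𝔡^{≤1}B + (Γ_g·Ξ)·B + Γ_b·Γ_g·A`"; the printed schematic tail is `−3sP·X̂` here
(reading R3: `[v1]` drops `Γ_b·Γ_g·A` in the last member, `[J]` keeps it).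
[cite: GiorgiKlainermanSzeftel2024, p0816 L28–84 (D.1.6); GiorgiKlainermanSzeftel2022, l.33527–33539, l.5243, l.5263] -/
theorem D1_6
    (hXh4 : N2.op Xh + rex • Xh = (1/2 : K) • Dh Xi + (1/2 : K) • hot Xi (Hb + H) - A)
    (hrex : rex = (1/2 : K) * (x + xc)) (hP4 : D4 pb = -((3/2 : K) * xc * pb) + sP) :
    -((3 * D4 pb) • Xh) - (3 * pb) • N2.op Xh
      = (((3/2 : K) * x + 6 * xc) * pb) • Xh + (3 * pb) • A
        - ((3/2 : K) * pb) • (Dh Xi + hot Xi (Hb + H)) - (3 * sP) • Xh := by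
  have h : N2.op Xh = (1/2 : K) • Dh Xi + (1/2 : K) • hot Xi (Hb + H) - A - rex • Xh :=
    eq_sub_of_add_eq hXh4
  subst hrex
  rw [h, hP4]
  module

/-- The WEIGHTS of the sum (divergence Δ2 of the header).  The display obtained by applying `ᶜ∇₄`
to (D.1.1) (`hN`, theorem `D1_apply_nab4`) is LITERALLY `½·[lhs of (D.1.3)] + [lhs of (D.1.4)]
+ ½·[lhs of (D.1.5)] + [lhs of (D.1.6)]` — `[J]` p0816 L85 "Summing ½(D.1.3), (D.1.4),
½(D.1.5) and (D.1.6)"; `[v1]` l.33541 prints "½(term1), (term2), (term3) and (term4)".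
[cite: GiorgiKlainermanSzeftel2024, p0816 L85; GiorgiKlainermanSzeftel2022, l.33541] -/
theorem D1_weights
    (hN : N2.op n3A = (1/2 : K) • N2.op (Dh B) - ((1/2 : K) * D4 xb) • A - ((1/2 : K) * xb) • N2.op A
      + (2 : K) • hot (N1.op H) B + (2 : K) • hot H (N1.op B) - (3 * D4 pb) • Xh
      - (3 * pb) • N2.op Xh) :
    N2.op n3A = (1/2 : K) • (N2.op (Dh B) + (4 : K) • hot H (N1.op B))
      + (-(((1/2 : K) * D4 xb) • A) - ((1/2 : K) * xb) • N2.op A)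
      + (1/2 : K) • ((4 : K) • hot (N1.op H) B)
      + (-((3 * D4 pb) • Xh) - (3 * pb) • N2.op Xh) := by
  rw [hN]
  module

/-- `[v1]` WEIGHT GAP (divergence Δ2): with the weights as worded at `[v1]` l.33541 (`1` on
`term3`) the sum is `ᶜ∇₄ᶜ∇₃A + 2ᶜ∇₄H⊗̂B`, not `ᶜ∇₄ᶜ∇₃A`.
[cite: GiorgiKlainermanSzeftel2022, l.33541; GiorgiKlainermanSzeftel2024, p0816 L85] -/
theorem D1_v1_weights_gap
    (hN : N2.op n3A = (1/2 : K) • N2.op (Dh B) - ((1/2 : K) * D4 xb) • A - ((1/2 : K) * xb) • N2.op A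
      + (2 : K) • hot (N1.op H) B + (2 : K) • hot H (N1.op B) - (3 * D4 pb) • Xh
      - (3 * pb) • N2.op Xh) :
    (1/2 : K) • (N2.op (Dh B) + (4 : K) • hot H (N1.op B))
      + (-(((1/2 : K) * D4 xb) • A) - ((1/2 : K) * xb) • N2.op A)
      + (4 : K) • hot (N1.op H) B
      + (-((3 * D4 pb) • Xh) - (3 * pb) • N2.op Xh)
      = N2.op n3A + (2 : K) • hot (N1.op H) B := by
  rw [hN]
  module

/-- `[v1]` `Ξ`-CHANNEL (divergence Δ1): summing `½·term1` (the (D.1.2) form, `[v1]` l.33505)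
and `term4` leaves `(9/2)P̄H⊗̂Ξ + (3/2)ᶜ𝒟P̄⊗̂Ξ` (first conjunct, using the symmetry of `⊗̂`),
absent from `[v1]`'s summed display l.33543–33547; under `[J]`'s rewriting `ᶜ𝒟P̄ = −3P̄H + EP`
it is the schematic `(3/2)EP⊗̂Ξ` (second conjunct).
[cite: GiorgiKlainermanSzeftel2022, l.33505, l.33538, l.33543–33547; GiorgiKlainermanSzeftel2024, p0815 L60–110, p0816 L85–128] -/
theorem D1_v1_Xi_channel (hsym : ∀ u v : M₁, hot u v = hot v u)
    (hDPb : dd pb = -((3 * pb) • H) + EP) :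
    (1/2 : K) • ((3 * pb) • (Dh Xi + hot ((4 : K) • H + Hb) Xi) + (3 : K) • hot (dd pb) Xi)
        - ((3/2 : K) * pb) • (Dh Xi + hot Xi (Hb + H))
      = ((9/2 : K) * pb) • hot H Xi + (3/2 : K) • hot (dd pb) Xi ∧
    ((9/2 : K) * pb) • hot H Xi + (3/2 : K) • hot (dd pb) Xi = (3/2 : K) • hot EP Xi := by
  constructor
  · rw [hsym Xi (Hb + H)]
    simp only [map_add, map_smul, LinearMap.add_apply, LinearMap.smul_apply]
    module
  · rw [hDPb]
    simp only [map_add, map_neg, map_smul, LinearMap.add_apply, LinearMap.smul_apply, LinearMap.neg_apply]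
    module

/-- THE SUM "`½(D.1.3) + (D.1.4) + ½(D.1.5) + (D.1.6)`": "we obtain `ᶜ∇₄ᶜ∇₃A = (−½tr X
− 2conj(tr X))½ᶜ𝒟⊗̂B + ((3/2)tr X + 6conj(tr X))P̄X̂ + (−ᶜ𝒟conj(tr X) − 5conj(tr X)H)⊗̂B
+ (¼tr X tr X̲ − ½(ᶜ𝒟·H̲̄ + H̲·H̲̄) + 2P̄)A − ½tr X̲ ᶜ∇₄A + ¼ᶜ𝒟⊗̂(conj(ᶜ𝒟)·A + H̲̄·A)
+ (H + ¼H̲)⊗̂(conj(ᶜ𝒟)·A + H̲̄·A) + r⁻¹𝔡^{≤1}Γ_g·B + ᶜ∇₃Ξ·B + r⁻¹𝔡̸^{≤1}P̌·Ξ + r⁻³Γ_b·Ξ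
+ (Γ_g·Ξ)·B`" (`[v1]`: `… + r⁻¹𝔡^{≤1}(Γ_g·B) + ᶜ∇₃Ξ·B + Γ_b·Γ_g·A`), the schematic tail being
the explicit `R₁` of §1.  Kernel content: the `Ξ`-channel `(3/2)P̄[(H + H̲)⊗̂Ξ − Ξ⊗̂(H̲ + H)]`
vanishes by the symmetry of `⊗̂` (`hsym`); the `⊗̂B`-coefficient is
`−ᶜ𝒟conj(tr X) − 4conj(tr X)H − conj(tr X)H̲ − conj(tr X)H + conj(tr X)H̲ = −ᶜ𝒟conj(tr X)
− 5conj(tr X)H`; the `A`-coefficient `−P̄ + 3P̄ = 2P̄`.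
[cite: GiorgiKlainermanSzeftel2024, p0816 L85–128; GiorgiKlainermanSzeftel2022, l.33541–33548] -/
theorem D1_sum (hsym : ∀ u v : M₁, hot u v = hot v u)
    (hW : N2.op n3A = (1/2 : K) • (N2.op (Dh B) + (4 : K) • hot H (N1.op B))
      + (-(((1/2 : K) * D4 xb) • A) - ((1/2 : K) * xb) • N2.op A)
      + (1/2 : K) • ((4 : K) • hot (N1.op H) B)
      + (-((3 * D4 pb) • Xh) - (3 * pb) • N2.op Xh))
    (h13 : N2.op (Dh B) + (4 : K) • hot H (N1.op B)
      = (1/2 : K) • Dh (dbA + cHbA) + (-((1/2 : K) * x) - 2 * xc) • Dh B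
        + hot ((2 : K) • H + (1/2 : K) • Hb) (dbA + cHbA)
        + (2 : K) • hot (-dd xc - xc • ((4 : K) • H + Hb)) B
        + (3 * pb) • (Dh Xi + hot (H + Hb) Xi) + (3 : K) • hot EP Xi + G1)
    (h14 : -(((1/2 : K) * D4 xb) • A) - ((1/2 : K) * xb) • N2.op A
      = ((1/4 : K) * x * xb - (1/2 : K) * (dcHb + hh) - pb) • A - ((1/2 : K) * xb) • N2.op A
        - ((1/2 : K) * gb1) • A)
    (h15 : (4 : K) • hot (N1.op H) B
      = -((2 * xc) • hot (H - Hb) B) + ((4 : K) • hot n3Xi B - (2 : K) • hot XhH B - (4 : K) • hot B B))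
    (h16 : -((3 * D4 pb) • Xh) - (3 * pb) • N2.op Xh
      = (((3/2 : K) * x + 6 * xc) * pb) • Xh + (3 * pb) • A
        - ((3/2 : K) * pb) • (Dh Xi + hot Xi (Hb + H)) - (3 * sP) • Xh) :
    N2.op n3A = (-((1/2 : K) * x) - 2 * xc) • ((1/2 : K) • Dh B) + (((3/2 : K) * x + 6 * xc) * pb) • Xh
      + hot (-dd xc - (5 * xc) • H) B
      + ((1/4 : K) * x * xb - (1/2 : K) * (dcHb + hh) + 2 * pb) • A - ((1/2 : K) * xb) • N2.op A
      + (1/4 : K) • Dh (dbA + cHbA) + hot (H + (1/4 : K) • Hb) (dbA + cHbA)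
      + ((1/2 : K) • G1 - ((1/2 : K) * gb1) • A + ((2 : K) • hot n3Xi B - hot XhH B - (2 : K) • hot B B)
        + (3/2 : K) • hot EP Xi - (3 * sP) • Xh) := by
  rw [hW, h13, h14, h15, h16, hsym Xi (Hb + H)]
  simp only [map_add, map_sub, map_neg, map_smul, LinearMap.add_apply, LinearMap.sub_apply,
    LinearMap.neg_apply, LinearMap.smul_apply]
  module

/-- "Using again (D.1.1) we have `(−½tr X − 2conj(tr X))½ᶜ𝒟⊗̂B + ((3/2)tr X + 6conj(tr X))P̄X̂
= (−½tr X − 2conj(tr X))(½ᶜ𝒟⊗̂B − 3P̄X̂) = (−½tr X − 2conj(tr X))(ᶜ∇₃A + ½tr X̲ A − 2H⊗̂B)`."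
[cite: GiorgiKlainermanSzeftel2024, p0816 L129–168; GiorgiKlainermanSzeftel2022, l.33549–33554] -/
theorem D1_using_again
    (hA : n3A - (1/2 : K) • Dh B = -(((1/2 : K) * xb) • A) + (2 : K) • hot H B - (3 * pb) • Xh) :
    (-((1/2 : K) * x) - 2 * xc) • ((1/2 : K) • Dh B) + (((3/2 : K) * x + 6 * xc) * pb) • Xh
      = (-((1/2 : K) * x) - 2 * xc) • (n3A + ((1/2 : K) * xb) • A - (2 : K) • hot H B) := by
  rw [sub_eq_iff_eq_add'] at hA
  rw [hA]
  module

/-- "This gives `ᶜ∇₄ᶜ∇₃A = (−½tr X − 2conj(tr X))ᶜ∇₃A − ½tr X̲ ᶜ∇₄A + (−ᶜ𝒟conj(tr X)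
+ (tr X − conj(tr X))H)⊗̂B + (−conj(tr X) tr X̲ − ½(ᶜ𝒟·H̲̄ + H̲·H̲̄) + 2P̄)A
+ ¼ᶜ𝒟⊗̂(conj(ᶜ𝒟)·A + H̲̄·A) + (H + ¼H̲)⊗̂(conj(ᶜ𝒟)·A + H̲̄·A) + [R₁]`" — from the summed
display (`hS`) and (D.1.1) (`hA`): `−5conj(tr X)H + (−½tr X − 2conj(tr X))(−2H) = (tr X
− conj(tr X))H`, `¼tr X tr X̲ + (−½tr X − 2conj(tr X))½tr X̲ = −conj(tr X) tr X̲`.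
[cite: GiorgiKlainermanSzeftel2024, p0817 L5–41; GiorgiKlainermanSzeftel2022, l.33555–33562] -/
theorem D1_this_gives
    (hS : N2.op n3A = (-((1/2 : K) * x) - 2 * xc) • ((1/2 : K) • Dh B) + (((3/2 : K) * x + 6 * xc) * pb) • Xh
      + hot (-dd xc - (5 * xc) • H) B
      + ((1/4 : K) * x * xb - (1/2 : K) * (dcHb + hh) + 2 * pb) • A - ((1/2 : K) * xb) • N2.op A
      + (1/4 : K) • Dh (dbA + cHbA) + hot (H + (1/4 : K) • Hb) (dbA + cHbA)
      + ((1/2 : K) • G1 - ((1/2 : K) * gb1) • A + ((2 : K) • hot n3Xi B - hot XhH B - (2 : K) • hot B B)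
        + (3/2 : K) • hot EP Xi - (3 * sP) • Xh))
    (hA : n3A - (1/2 : K) • Dh B = -(((1/2 : K) * xb) • A) + (2 : K) • hot H B - (3 * pb) • Xh) :
    N2.op n3A = (-((1/2 : K) * x) - 2 * xc) • n3A - ((1/2 : K) * xb) • N2.op A
      + hot (-dd xc + (x - xc) • H) B
      + (-(xc * xb) - (1/2 : K) * (dcHb + hh) + 2 * pb) • A
      + (1/4 : K) • Dh (dbA + cHbA) + hot (H + (1/4 : K) • Hb) (dbA + cHbA)
      + ((1/2 : K) • G1 - ((1/2 : K) * gb1) • A + ((2 : K) • hot n3Xi B - hot XhH B - (2 : K) • hot B B)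
        + (3/2 : K) • hot EP Xi - (3 * sP) • Xh) := by
  rw [hS]
  rw [sub_eq_iff_eq_add'] at hA
  rw [hA]
  simp only [map_add, map_sub, map_neg, map_smul, LinearMap.add_apply, LinearMap.sub_apply,
    LinearMap.neg_apply, LinearMap.smul_apply]
  module

/-- "By the Codazzi equation `½conj(ᶜ𝒟)·X̂ = ½ᶜ𝒟conj(tr X) − i Im(tr X)(H + Ξ) − B` (`hCod`,
with `jx = i Im(tr X)`, `2jx = tr X − conj(tr X)` (`hjx`), and a free `Ξ`-coefficient `jxi`,
reading R2), the second line is absorbed by the quadratic terms in the last line": EXACTLY,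
`(−ᶜ𝒟conj(tr X) + (tr X − conj(tr X))H)⊗̂B = −(conj(ᶜ𝒟)·X̂)⊗̂B − 2jxi Ξ⊗̂B − 2B⊗̂B` (= `R₂`;
the `H⊗̂B` terms cancel identically).
[cite: GiorgiKlainermanSzeftel2024, p0817 L43–51; GiorgiKlainermanSzeftel2022, l.33563–33567, l.5251] -/
theorem D1_codazzi_absorb
    (hCod : (1/2 : K) • dbXh = (1/2 : K) • dd xc - jx • H - jxi • Xi - B) (hjx : 2 * jx = x - xc) :
    hot (-dd xc + (x - xc) • H) B = -(hot dbXh B) - (2 * jxi) • hot Xi B - (2 : K) • hot B B := by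
  have hd : dbXh = dd xc - (2 * jx) • H - (2 * jxi) • Xi - (2 : K) • B := by
    linear_combination (norm := module) (2 : K) • hCod
  rw [← hjx, hd]
  simp only [map_add, map_sub, map_neg, map_smul, LinearMap.add_apply, LinearMap.sub_apply,
    LinearMap.neg_apply, LinearMap.smul_apply]
  module

/-- "We also simplify `¼ᶜ𝒟⊗̂(conj(ᶜ𝒟)·A + H̲̄·A) + (H + ¼H̲)⊗̂(conj(ᶜ𝒟)·A + H̲̄·A) = ¼ᶜ𝒟⊗̂(conj(ᶜ𝒟)·A)
+ ¼ᶜ𝒟⊗̂(H̲̄·A) + (H + ¼H̲)⊗̂(conj(ᶜ𝒟)·A) + (H + ¼H̲)⊗̂(H̲̄·A)`.  Applying (2.4.2) and (2.4.4), we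
write `ᶜ𝒟⊗̂(H̲̄·A) = 2(ᶜ𝒟·H̲̄)A + 2(H̲̄·ᶜ𝒟)A` (`hLH`, `[v1]` (`Leibniz-hot`) l.4985),
`H̲⊗̂(H̲̄·A) = 2(H̲·H̲̄)A` (`hSL`, `[v1]` (`simil-Leibniz`) l.4930 at `E = F = H̲`), which implies
`ᶜ∇₄ᶜ∇₃A = ¼ᶜ𝒟⊗̂(conj(ᶜ𝒟)·A) + (−½tr X − 2conj(tr X))ᶜ∇₃A − ½tr X̲ ᶜ∇₄A + ½(H̲̄·ᶜ𝒟)A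
+ (H + ¼H̲)⊗̂(conj(ᶜ𝒟)·A) + (−conj(tr X) tr X̲ + 2P̄)A + H⊗̂(H̲̄·A) + [R₁ + R₂]`" — from "This
gives" (`hTG`) and the Codazzi absorption (`hCA`); the `−½(ᶜ𝒟·H̲̄ + H̲·H̲̄)A` is cancelled by
`¼·2(ᶜ𝒟·H̲̄)A + ¼·2(H̲·H̲̄)A`.
[cite: GiorgiKlainermanSzeftel2024, p0817 L51 – p0818 L69, (2.4.2) p0111 L40, (2.4.4) p0112 L27; GiorgiKlainermanSzeftel2022, l.33568–33587, l.4930, l.4985] -/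
theorem D1_which_implies
    (hTG : N2.op n3A = (-((1/2 : K) * x) - 2 * xc) • n3A - ((1/2 : K) * xb) • N2.op A
      + hot (-dd xc + (x - xc) • H) B
      + (-(xc * xb) - (1/2 : K) * (dcHb + hh) + 2 * pb) • A
      + (1/4 : K) • Dh (dbA + cHbA) + hot (H + (1/4 : K) • Hb) (dbA + cHbA)
      + ((1/2 : K) • G1 - ((1/2 : K) * gb1) • A + ((2 : K) • hot n3Xi B - hot XhH B - (2 : K) • hot B B)
        + (3/2 : K) • hot EP Xi - (3 * sP) • Xh))
    (hCA : hot (-dd xc + (x - xc) • H) B = -(hot dbXh B) - (2 * jxi) • hot Xi B - (2 : K) • hot B B)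
    (hLH : Dh cHbA = (2 * dcHb) • A + (2 : K) • FD cHb) (hSL : hot Hb cHbA = (2 * hh) • A) :
    N2.op n3A = (1/4 : K) • Dh dbA + (-((1/2 : K) * x) - 2 * xc) • n3A - ((1/2 : K) * xb) • N2.op A
      + (1/2 : K) • FD cHb + hot (H + (1/4 : K) • Hb) dbA + (-(xc * xb) + 2 * pb) • A + hot H cHbA
      + (((1/2 : K) • G1 - ((1/2 : K) * gb1) • A + ((2 : K) • hot n3Xi B - hot XhH B - (2 : K) • hot B B)
          + (3/2 : K) • hot EP Xi - (3 * sP) • Xh)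
        + (-(hot dbXh B) - (2 * jxi) • hot Xi B - (2 : K) • hot B B)) := by
  rw [hTG, hCA]
  simp only [map_add, map_smul, LinearMap.add_apply, LinearMap.smul_apply, hLH, hSL]
  module

/-- "Using (2.4.5), we further simplify the angular part writing `½(H̲̄·ᶜ𝒟)A + (H + ¼H̲)⊗̂(conj(ᶜ𝒟)·A)
= ½(H̲̄·ᶜ𝒟)A + (2H + ½H̲)·conj(ᶜ𝒟)A = ½(H̲̄·ᶜ𝒟 + H̲·conj(ᶜ𝒟))A + (2H·conj(ᶜ𝒟))A
= (4H + H̲ + H̲̄)·ᶜ∇A`" — from `F⊗̂(conj(ᶜ𝒟)·U) = 2(F·conj(ᶜ𝒟))U = 4F·ᶜ∇U` (`hLeibDDb`, `[v1]`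
(`Leib-eq-DDb`) l.4992, at `U = A`, all `F`) and `(F·conj(ᶜ𝒟))U + (F̄·ᶜ𝒟)U = 2(F + F̄)·ᶜ∇U`
(`hLeibnab`, `[v1]` (`Leib-eq-DDb-DD-nab`) l.4993, at `F = H̲`, `U = A`).
[cite: GiorgiKlainermanSzeftel2024, p0818 L71–96, (2.4.5) p0112 L36; GiorgiKlainermanSzeftel2022, l.33589–33595, l.4992–4993] -/
theorem D1_angular
    (hLeibDDb : ∀ F : M₁, hot F dbA = (2 : K) • FDb F ∧ (2 : K) • FDb F = (4 : K) • Fnab F)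
    (hLeibnab : FDb Hb + FD cHb = (2 : K) • Fnab (Hb + cHb)) :
    (1/2 : K) • FD cHb + hot (H + (1/4 : K) • Hb) dbA = Fnab ((4 : K) • H + Hb + cHb) := by
  rw [(hLeibDDb (H + (1/4 : K) • Hb)).1]
  have hH : (2 : K) • FDb H = (4 : K) • Fnab H := (hLeibDDb H).2
  have hHb : FDb Hb = (2 : K) • Fnab (Hb + cHb) - FD cHb := eq_sub_of_add_eq hLeibnab
  simp only [map_add, map_smul]
  rw [hHb, smul_add, hH]
  simp only [map_add]
  module

/-- **Proposition 5.1.1 (the Teukolsky equation for `A`), last step**: "This proves the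
proposition" — from "which implies" (`hWI`) and the angular simplification (`hang`),
`𝓛(A) := −ᶜ∇₄ᶜ∇₃A + ¼ᶜ𝒟⊗̂(conj(ᶜ𝒟)·A) + (−½tr X − 2conj(tr X))ᶜ∇₃A − ½tr X̲ ᶜ∇₄A
+ (4H + H̲ + H̲̄)·ᶜ∇A + (−conj(tr X)tr X̲ + 2P̄)A + H⊗̂(H̲̄·A)` (`[J]` (5.1.2)) equals `−(R₁ + R₂)`,
the itemised form of `Err[𝓛(A)]` (`[J]` (5.1.3); `[v1]` l.8581; divergence Δ3 — the schematic
classes are sign-blind, cf. `TeukolskyAbarLedger.final_form_sign`).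
[cite: GiorgiKlainermanSzeftel2024, Proposition 5.1.1 (5.1.1)–(5.1.3) p0188 L17–49, p0818 L97; GiorgiKlainermanSzeftel2022, l.8567–8583, l.33595] -/
theorem D1_teukolsky
    (hWI : N2.op n3A = (1/4 : K) • Dh dbA + (-((1/2 : K) * x) - 2 * xc) • n3A - ((1/2 : K) * xb) • N2.op A
      + (1/2 : K) • FD cHb + hot (H + (1/4 : K) • Hb) dbA + (-(xc * xb) + 2 * pb) • A + hot H cHbA
      + (((1/2 : K) • G1 - ((1/2 : K) * gb1) • A + ((2 : K) • hot n3Xi B - hot XhH B - (2 : K) • hot B B)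
          + (3/2 : K) • hot EP Xi - (3 * sP) • Xh)
        + (-(hot dbXh B) - (2 * jxi) • hot Xi B - (2 : K) • hot B B)))
    (hang : (1/2 : K) • FD cHb + hot (H + (1/4 : K) • Hb) dbA = Fnab ((4 : K) • H + Hb + cHb)) :
    -(N2.op n3A) + (1/4 : K) • Dh dbA + (-((1/2 : K) * x) - 2 * xc) • n3A - ((1/2 : K) * xb) • N2.op A
      + Fnab ((4 : K) • H + Hb + cHb) + (-(xc * xb) + 2 * pb) • A + hot H cHbA
      = -(((1/2 : K) • G1 - ((1/2 : K) * gb1) • A + ((2 : K) • hot n3Xi B - hot XhH B - (2 : K) • hot B B)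
          + (3/2 : K) • hot EP Xi - (3 * sP) • Xh)
        + (-(hot dbXh B) - (2 * jxi) • hot Xi B - (2 : K) • hot B B)) := by
  rw [hWI, ← hang]
  module

/-- **Proposition 5.1.1 composed from the quoted rows** (App. D.1 end to end): the Leibniz rules
of `ᶜ∇₄` over `⊗̂` (`hN4hot`) and of `ᶜ𝒟⊗̂` (`hDhL`), the symmetry of `⊗̂` (`hsym`), the Bianchi
identities (D.1.1) (`hA`), for `B` (`hBB`), for `P̄` (`hP4`), the commutator (`hcomm`), `[J]`'s
Kerr rewriting of `ᶜ𝒟P̄` (`hDPb`), the transport equations for `tr X̲` (`htrXb`), `H` (`hH4`),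
`X̂` (`hXh4`, `hrex`), the Codazzi equation (`hCod`, `hjx`), the Leibniz rules (2.4.2) (`hSL`),
(2.4.4) (`hLH`), (2.4.5) (`hLeibDDb`, `hLeibnab`) ⟹ `𝓛(A) = −(R₁ + R₂)`.
[cite: GiorgiKlainermanSzeftel2024, App. D.1 p0814 L5 – p0818 L97, Proposition 5.1.1 p0188; GiorgiKlainermanSzeftel2022, l.33469–33595, l.8567–8583] -/
theorem D1_teukolsky_of_rows
    (hN4hot : ∀ u v : M₁, N2.op (hot u v) = hot (N1.op u) v + hot u (N1.op v))
    (hDhL : ∀ (f : K) (u : M₁), Dh (f • u) = f • Dh u + hot (dd f) u)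
    (hsym : ∀ u v : M₁, hot u v = hot v u)
    (hA : n3A - (1/2 : K) • Dh B = -(((1/2 : K) * xb) • A) + (2 : K) • hot H B - (3 * pb) • Xh)
    (hcomm : N2.op (Dh B) - Dh (N1.op B) = -(((1/2 : K) * x) • Dh B) + hot Hb (N1.op B) + G1)
    (hBB : N1.op B - (1/2 : K) • dbA = -((2 * xc) • B) + (1/2 : K) • cHbA + (3 * pb) • Xi)
    (hDPb : dd pb = -((3 * pb) • H) + EP)
    (htrXb : D4 xb + (1/2 : K) * x * xb = dcHb + hh + 2 * pb + gb1)
    (hH4 : N1.op H - n3Xi = -(((1/2 : K) * xc) • (H - Hb)) - (1/2 : K) • XhH - B)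
    (hXh4 : N2.op Xh + rex • Xh = (1/2 : K) • Dh Xi + (1/2 : K) • hot Xi (Hb + H) - A)
    (hrex : rex = (1/2 : K) * (x + xc)) (hP4 : D4 pb = -((3/2 : K) * xc * pb) + sP)
    (hCod : (1/2 : K) • dbXh = (1/2 : K) • dd xc - jx • H - jxi • Xi - B) (hjx : 2 * jx = x - xc)
    (hLH : Dh cHbA = (2 * dcHb) • A + (2 : K) • FD cHb) (hSL : hot Hb cHbA = (2 * hh) • A)
    (hLeibDDb : ∀ F : M₁, hot F dbA = (2 : K) • FDb F ∧ (2 : K) • FDb F = (4 : K) • Fnab F)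
    (hLeibnab : FDb Hb + FD cHb = (2 : K) • Fnab (Hb + cHb)) :
    -(N2.op n3A) + (1/4 : K) • Dh dbA + (-((1/2 : K) * x) - 2 * xc) • n3A - ((1/2 : K) * xb) • N2.op A
      + Fnab ((4 : K) • H + Hb + cHb) + (-(xc * xb) + 2 * pb) • A + hot H cHbA
      = -(((1/2 : K) • G1 - ((1/2 : K) * gb1) • A + ((2 : K) • hot n3Xi B - hot XhH B - (2 : K) • hot B B)
          + (3/2 : K) • hot EP Xi - (3 * sP) • Xh)
        + (-(hot dbXh B) - (2 * jxi) • hot Xi B - (2 : K) • hot B B)) := by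
  have hN := D1_apply_nab4 N1 N2 Dh hot xb pb H B A Xh n3A hN4hot hA
  have hW := D1_weights N1 N2 Dh hot xb pb H B A Xh n3A hN
  have hWTO := D1_we_therefore_obtain N1 N2 Dh hot x H Hb B G1 hcomm
  have h12 := D1_2 N1 N2 dd Dh hot x xc pb H Hb Xi B dbA cHbA G1 hWTO hBB hDhL
  have h13 := D1_3 N1 N2 dd Dh hot x xc pb H Hb Xi B dbA cHbA EP G1 h12 hDPb
  have h14 := D1_4 N2 x xb pb dcHb hh gb1 A htrXb
  have h15 := D1_5 N1 hot xc H Hb B n3Xi XhH hH4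
  have h16 := D1_6 N2 Dh hot x xc pb sP rex H Hb Xi A Xh hXh4 hrex hP4
  have hS := D1_sum N1 N2 dd Dh hot x xc xb pb dcHb hh gb1 sP H Hb Xi B dbA cHbA n3Xi XhH EP A Xh n3A G1
    hsym hW h13 h14 h15 h16
  have hTG := D1_this_gives N2 dd Dh hot x xc xb pb dcHb hh gb1 sP H Hb Xi B dbA cHbA n3Xi XhH EP A Xh
    n3A G1 hS hA
  have hCA := D1_codazzi_absorb dd hot x xc jx jxi H Xi B dbXh hCod hjx
  have hWI := D1_which_implies N2 dd Dh hot FD x xc xb pb dcHb hh gb1 sP jxi H Hb cHb Xi B dbA cHbA n3Xi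
    XhH dbXh EP A Xh n3A G1 hTG hCA hLH hSL
  have hang := D1_angular hot FDb FD Fnab H Hb cHb dbA hLeibDDb hLeibnab
  exact D1_teukolsky N2 Dh hot FD Fnab x xc xb pb gb1 sP jxi H Hb cHb Xi B dbA cHbA n3Xi XhH dbXh EP A Xh
    n3A G1 hWI hang

end D1

/-! ## §3 App. D.2: Corollary 5.1.2 (the real and imaginary parts of `𝓛`)

Scalars: `trch = tr χ`, `atrch = ªtr χ`, `trchb = tr χ̲`, `atrchb = ªtr χ̲`, `rho = ρ`,
`drho = *ρ`, `ee = η·η̲`, `ew = η∧η̲`, and `I` with `I² = −1`; 1-forms `eta = η`, `deta = *η`,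
`etab = η̲`, `detab = *η̲`; 2-tensors `n43A = ᶜ∇₄ᶜ∇₃A`, `lapA = ᶜΔ₂A`, `n3A = ᶜ∇₃A`, `n4A = ᶜ∇₄A`,
`DhdbA = ᶜ𝒟⊗̂(conj(ᶜ𝒟)·A)`, `HHA = H⊗̂(H̲̄·A)`; `Fnab F = F·ᶜ∇A`. -/

section D2

variable [CharZero K]
variable {M₁ M₂ : Type*} [AddCommGroup M₁] [Module K M₁] [AddCommGroup M₂] [Module K M₂]

/-- "Writing `−½tr X̲ = −½tr χ̲ + ½iªtr χ̲`, `−½tr X − 2conj(tr X) = −(5/2)tr χ + i(−(3/2)ªtr χ)`,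
`−conj(tr X) tr X̲ + 2P̄ = −tr χ tr χ̲ − ªtr χ ªtr χ̲ + 2ρ + i(tr χ ªtr χ̲ − tr χ̲ ªtr χ − 2*ρ)`"
with `tr X = tr χ − iªtr χ`, `tr X̲ = tr χ̲ − iªtr χ̲`, `P = ρ + i*ρ` (`[J]` Definition 2.4.8);
the third needs `i² = −1`.
[cite: GiorgiKlainermanSzeftel2024, p0819 L28–47, Definition 2.4.8 p0113 L29–52; GiorgiKlainermanSzeftel2022, l.33616–33622, l.5053] -/
theorem D2_writing (I trch atrch trchb atrchb rho drho : K) (hI : I * I = -1) :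
    -(1/2 : K) * (trchb - I * atrchb) = -(1/2 : K) * trchb + (1/2 : K) * I * atrchb ∧
    -(1/2 : K) * (trch - I * atrch) - 2 * (trch + I * atrch)
      = -(5/2 : K) * trch + I * (-(3/2 : K) * atrch) ∧
    -((trch + I * atrch) * (trchb - I * atrchb)) + 2 * (rho - I * drho)
      = -(trch * trchb) - atrch * atrchb + 2 * rho + I * (trch * atrchb - trchb * atrch - 2 * drho) := by
  refine ⟨by ring, by ring, ?_⟩
  linear_combination (atrch * atrchb) * hI

/-- **Corollary 5.1.2**: "Applying Lemma 4.7.8 to `A`, which is `2`-conformally invariant, we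
obtain `ᶜ𝒟⊗̂(conj(ᶜ𝒟)·A) = 4ᶜΔ₂A − 2i(ªtr χ ᶜ∇₃ + ªtr χ̲ ᶜ∇₄)A + 2(tr χ tr χ̲ + ªtr χ ªtr χ̲
+ 4ρ)A − 2i(tr χ ªtr χ̲ − tr χ̲ ªtr χ + 4*ρ)A` (`hlap`).  From (5.1.2), we then obtain … Writing
[`D2_writing`] … we obtain … Using (2.4.3), we write `H⊗̂(H̲̄·A) = (4η·η̲ − 4iη∧η̲)A` (D.2.1)
(`hD21`), and this completes the proof": with `H = η + i*η`, `H̲ = η̲ + i*η̲`, `H̲̄ = η̲ − i*η̲`,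
`𝓛(A) = Re(𝓛)(A) + i Im(𝓛)(A)` where `Re(𝓛)(A) = −ᶜ∇₄ᶜ∇₃A + ᶜΔ₂A + (4η + 2η̲)·ᶜ∇A
− ½tr χ̲ ᶜ∇₄A − (5/2)tr χ ᶜ∇₃A + (−½tr χ tr χ̲ − ½ªtr χ ªtr χ̲ + 4ρ + 4η·η̲)A` and
`Im(𝓛)(A) = −2ªtr χ ᶜ∇₃A + 4*η·ᶜ∇A + (½tr χ ªtr χ̲ − ½tr χ̲ ªtr χ − 4*ρ − 4η∧η̲)A` — the
printed Corollary 5.1.2.  Only the `A`-coefficient needs `i² = −1`.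
[cite: GiorgiKlainermanSzeftel2024, Corollary 5.1.2 p0189 L8–35, App. D.2 p0818 L99 – p0819 L86 (D.2.1), Lemma 4.7.8 p0182 L51–74; GiorgiKlainermanSzeftel2022, l.8591–8603, l.33600–33633, l.8260] -/
theorem D2_split (Fnab : M₁ →ₗ[K] M₂)
    (I trch atrch trchb atrchb rho drho ee ew x xc xb pb : K) (hI : I * I = -1)
    (H Hb cHb eta deta etab detab : M₁) (A n43A lapA n3A n4A DhdbA HHA : M₂)
    (hx : x = trch - I * atrch) (hxc : xc = trch + I * atrch) (hxb : xb = trchb - I * atrchb)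
    (hpb : pb = rho - I * drho) (hH : H = eta + I • deta) (hHb : Hb = etab + I • detab)
    (hcHb : cHb = etab - I • detab)
    (hlap : DhdbA = (4 : K) • lapA - (2 * I) • (atrch • n3A + atrchb • n4A)
      + (2 * (trch * trchb + atrch * atrchb + 4 * rho)) • A
      - (2 * I * (trch * atrchb - trchb * atrch + 4 * drho)) • A)
    (hD21 : HHA = (4 * ee - 4 * I * ew) • A) :
    -n43A + (1/4 : K) • DhdbA + (-((1/2 : K) * x) - 2 * xc) • n3A - ((1/2 : K) * xb) • n4A
      + Fnab ((4 : K) • H + Hb + cHb) + (-(xc * xb) + 2 * pb) • A + HHA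
      = (-n43A + lapA + Fnab ((4 : K) • eta + (2 : K) • etab) - ((1/2 : K) * trchb) • n4A
          - ((5/2 : K) * trch) • n3A
          + (-(1/2 : K) * (trch * trchb) - (1/2 : K) * (atrch * atrchb) + 4 * rho + 4 * ee) • A)
        + I • (-(2 * atrch) • n3A + (4 : K) • Fnab deta
          + ((1/2 : K) * (trch * atrchb) - (1/2 : K) * (trchb * atrch) - 4 * drho - 4 * ew) • A) := by
  subst hx hxc hxb hpb hH hHb hcHb hlap hD21
  simp only [map_add, map_sub, map_smul, smul_add, smul_sub]
  match_scalars <;> first | ring1 | linear_combination (atrch * atrchb) * hI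

end D2

end Literature.Geometry.Lorentzian.GiorgiKlainermanSzeftel2022.TeukolskyALedger
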